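import Summits.RiemannHypothesis.RiemannHypothesis.Theorems.JensenLogBandArcSaddle
import HarnessLib

/-!
# Polar localisation of the model saddle (BAND line, step S3 — a-posteriori bounds)

RH ladder column JENSEN, rung J-P(P3) «log band», BAND crux `XiDerivBandRealAllRates` of route
«JensenLogBand», line «band-one-window» (u-arc reshape), lead rh-jensen-prover g7 — the
a-posteriori half of step (S3) of HOME/rh-jensen-prover/g7-work/LINE-PLAN.md §6. RH-FREE
(Γ-factor only). WHAT THIS IS NOT: nothing here bears on zeros of `ζ` or the truth of RH.

For a zero `u*` of the saddle function `S_{n,c}` in the disc `|u − (c+h)| ≤ (3/5)h`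
(`LogBandArc.exists_arcSaddleFn_eq_zero`) one has `u* − c = n / D(u*)`
(`LogBandArc.sub_eq_div_saddleDen_of_arcSaddleFn_eq_zero`), hence — from the bounds
`Re D ∈ [(9/20)ℓ, (14/25)ℓ]`, `Im D ∈ [−1/10, 9/10 + ℓ/10]` — the window CENTRE and RADIUS that
steps (S4)/(S5) analyse: `Re(u* − c) > 0`, `−(23/100)·Re(u*−c) ≤ −Im(u*−c) ≤ (8/25 + 2/ℓ)·Re(u*−c)`
(the saddle sits at angle `φ₀ ∈ [−0.33, 0.23]` below the horizontal through `c`, cf. the numerics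
`φ₀ ∈ [−0.41, −0.06]` of LINE-PLAN §5) and `(100/71)·n/ℓ ≤ ‖u* − c‖ ≤ (20/9)·n/ℓ`
(`h*/h ∈ [0.70, 1.12]`) — `LogBandArc.arcSaddle_polar_bounds`.
-/

noncomputable section

-- single-problem summit: `Summit.RiemannHypothesis.RiemannHypothesis.…` is the tree convention
set_option linter.dupNamespace false

open Complex Real

namespace Summit.RiemannHypothesis.RiemannHypothesis.Theorems.JensenPolynomials.LogBandArc

open Literature.NumberTheory.LFunctions

variable {n : ℕ} {x T : ℝ} {u : ℂ}

/-- A zero `u*` of `S_{n,c}` in the disc satisfies `u* − c = n / D(u*)`. [folklore] -/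
theorem sub_eq_div_saddleDen_of_arcSaddleFn_eq_zero (hx : |x| ≤ 1 / 2) (hT : 100 ≤ T)
    (hℓ : 20 ≤ ell T) (hn : 100 ≤ n) (hh : 1 / 2 ≤ bandRadius n T)
    (hhT : bandRadius n T ≤ 7 / 20 * T)
    (hu : ‖u - ((x : ℂ) + (T : ℂ) * I + bandRadius n T)‖ ≤ 3 / 5 * bandRadius n T)
    (hS : arcSaddleFn n ((x : ℂ) + (T : ℂ) * I) u = 0) :
    u - ((x : ℂ) + (T : ℂ) * I) = (n : ℂ) / saddleDen n ((x : ℂ) + (T : ℂ) * I) u := by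
  set c : ℂ := (x : ℂ) + (T : ℂ) * I with hc
  set h := bandRadius n T with hhdef
  have hh0 : 0 < h := by linarith
  obtain ⟨hD0, -⟩ := norm_div_saddleDen_sub_le hx hT hℓ hn hh hhT hu
  obtain ⟨-, -, hre_lo, -, -, -, hnu_lo, -⟩ := disc_geometry hx hT hh hhT hu
  have hre : 0 < (1 / 2 + u).re := by linarith
  have h1 : 1 / 2 + u ≠ 1 := by
    intro h0
    have him := congrArg Complex.im h0
    simp at him
    have : |u.im - T| ≤ 3 / 5 * h := (disc_coords hu).1
    rw [abs_le] at this
    linarith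
  have huc : u - c ≠ 0 := by
    intro h0
    have : ‖u - (c + h)‖ = h := by
      rw [show u - (c + (h : ℂ)) = (u - c) - h by ring, h0, zero_sub, norm_neg, Complex.norm_real,
        Real.norm_eq_abs, abs_of_pos hh0]
    have hu' : ‖u - (c + h)‖ ≤ 3 / 5 * h := hu
    linarith
  have hn0 : (n : ℂ) ≠ 0 := by exact_mod_cast (show n ≠ 0 by omega)
  rw [arcSaddleFn_eq_saddleDen_sub n c hre h1, sub_eq_zero] at hS
  -- `D = n/(u − c)` ⇒ `u − c = n/D`
  rw [hS]
  field_simp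

/-- **Polar localisation of the saddle.** For a zero `u*` of `S_{n,c}` in the disc:
`Re(u* − c) > 0`, `−(23/100)·Re(u* − c) ≤ −Im(u* − c) ≤ (8/25 + 2/ℓ_T)·Re(u* − c)` and
`(100/71)·n/ℓ_T ≤ ‖u* − c‖ ≤ (20/9)·n/ℓ_T`. [folklore] -/
theorem arcSaddle_polar_bounds (hx : |x| ≤ 1 / 2) (hT : 100 ≤ T)
    (hℓ : 20 ≤ ell T) (hn : 100 ≤ n) (hh : 1 / 2 ≤ bandRadius n T)
    (hhT : bandRadius n T ≤ 7 / 20 * T)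
    (hu : ‖u - ((x : ℂ) + (T : ℂ) * I + bandRadius n T)‖ ≤ 3 / 5 * bandRadius n T)
    (hS : arcSaddleFn n ((x : ℂ) + (T : ℂ) * I) u = 0) :
    0 < (u - ((x : ℂ) + (T : ℂ) * I)).re ∧
    -(23 / 100) * (u - ((x : ℂ) + (T : ℂ) * I)).re ≤ -(u - ((x : ℂ) + (T : ℂ) * I)).im ∧
    -(u - ((x : ℂ) + (T : ℂ) * I)).im ≤ (8 / 25 + 2 / ell T) * (u - ((x : ℂ) + (T : ℂ) * I)).re ∧
    100 / 71 * (n / ell T) ≤ ‖u - ((x : ℂ) + (T : ℂ) * I)‖ ∧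
    ‖u - ((x : ℂ) + (T : ℂ) * I)‖ ≤ 20 / 9 * (n / ell T) := by
  set c : ℂ := (x : ℂ) + (T : ℂ) * I with hc
  set ℓ := ell T with hℓdef
  have hℓ0 : 0 < ℓ := by linarith
  have heq := sub_eq_div_saddleDen_of_arcSaddleFn_eq_zero hx hT hℓ hn hh hhT hu hS
  obtain ⟨hR_lo, hR_hi, hJ_lo, hJ_hi⟩ := saddleDen_re_im_bounds hx hT hℓ hh hhT hu
  set D := saddleDen n c u with hD
  have hnpos : (0 : ℝ) < n := by exact_mod_cast (show 0 < n by omega)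
  have hRpos : 0 < D.re := by linarith
  have hnsq_pos : 0 < Complex.normSq D := by
    rw [Complex.normSq_pos]; intro h0; rw [h0] at hRpos; simp at hRpos
  -- real and imaginary parts of `n / D`
  have hre : (u - c).re = (n : ℝ) * D.re / Complex.normSq D := by
    rw [heq, Complex.div_re]; simp
  have him : (u - c).im = -((n : ℝ) * D.im) / Complex.normSq D := by
    rw [heq, Complex.div_im]; simp; ring
  have hre_pos : 0 < (u - c).re := by rw [hre]; positivity
  refine ⟨hre_pos, ?_, ?_, ?_, ?_⟩
  · -- `−Im(u−c) = n Im D/|D|² ≥ n (−1/10)/|D|² ≥ −(23/100) n Re D/|D|²` since `Re D ≥ 9ℓ/20 ≥ 9`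
    rw [hre, him, neg_div, neg_neg]
    rw [show -(23 / 100) * ((n : ℝ) * D.re / Complex.normSq D) =
      (n : ℝ) * (-(23 / 100) * D.re) / Complex.normSq D by ring]
    apply div_le_div_of_nonneg_right _ hnsq_pos.le
    apply mul_le_mul_of_nonneg_left _ hnpos.le
    linarith
  · rw [hre, him, neg_div, neg_neg]
    rw [show (8 / 25 + 2 / ℓ) * ((n : ℝ) * D.re / Complex.normSq D) =
      (n : ℝ) * ((8 / 25 + 2 / ℓ) * D.re) / Complex.normSq D by ring]
    apply div_le_div_of_nonneg_right _ hnsq_pos.le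
    apply mul_le_mul_of_nonneg_left _ hnpos.le
    -- `Im D ≤ 9/10 + ℓ/10 ≤ (8/25 + 2/ℓ) Re D` as `Re D ≥ 9ℓ/20`: `(8/25)(9ℓ/20) = 0.144ℓ ≥ ℓ/10`,
    -- `(2/ℓ)(9ℓ/20) = 9/10`.
    have h1 : (8 / 25 + 2 / ℓ) * (9 / 20 * ℓ) ≤ (8 / 25 + 2 / ℓ) * D.re :=
      mul_le_mul_of_nonneg_left hR_lo (by positivity)
    have h2 : (8 / 25 + 2 / ℓ) * (9 / 20 * ℓ) = 18 / 125 * ℓ + 9 / 10 := by field_simp; ring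
    linarith
  · -- `‖u − c‖ = n/‖D‖ ≥ n/(0.71 ℓ)` from `‖D‖ ≤ |Re D| + |Im D| ≤ 14ℓ/25 + 9/10 + ℓ/10 ≤ 71ℓ/100`
    rw [heq, norm_div, Complex.norm_natCast]
    have hDn : ‖D‖ ≤ 71 / 100 * ℓ := by
      have := Complex.norm_le_abs_re_add_abs_im D
      rw [abs_of_pos hRpos] at this
      have hJ : |D.im| ≤ 9 / 10 + ℓ / 10 := abs_le.2 ⟨by linarith, hJ_hi⟩
      linarith
    have hDpos : 0 < ‖D‖ := norm_pos_iff.2 (by intro h0; rw [h0] at hRpos; simp at hRpos)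
    rw [show 100 / 71 * ((n : ℝ) / ℓ) = (n : ℝ) / (71 / 100 * ℓ) by field_simp]
    exact div_le_div_of_nonneg_left hnpos.le hDpos hDn
  · rw [heq, norm_div, Complex.norm_natCast]
    have hDn : 9 / 20 * ℓ ≤ ‖D‖ := hR_lo.trans ((le_abs_self _).trans (Complex.abs_re_le_norm D))
    rw [show 20 / 9 * ((n : ℝ) / ℓ) = (n : ℝ) / (9 / 20 * ℓ) by field_simp]
    exact div_le_div_of_nonneg_left hnpos.le (by positivity) hDn

end Summit.RiemannHypothesis.RiemannHypothesis.Theorems.JensenPolynomials.LogBandArc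

end
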